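import Literature.AlgebraicGeometry.Resolution.RsopMonomialIdeals
import Literature.AlgebraicGeometry.Resolution.RegularLocalRingsFlatDescent
import Mathlib.RingTheory.Unramified.LocalRing
import Mathlib.RingTheory.Flat.FaithfullyFlat.Algebra
import Mathlib.RingTheory.TensorProduct.Quotient
import Mathlib.LinearAlgebra.TensorProduct.Prod
import Mathlib.RingTheory.Ideal.MinimalPrime.Noetherian
import Mathlib.RingTheory.Localization.FractionRing
import HarnessLib

/-!
# Étale local homomorphisms: orders, radicals, dimension, regular parameters

Topic: `Literature/AlgebraicGeometry/Resolution`. Local algebra of the stalk maps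
`𝒪_{S,s} → 𝒪_{S',s'}` of an étale morphism `S' → S` (flat, unramified, essentially of finite
type local homomorphisms of Noetherian local rings), as needed to move strict/normal crossings
data along the étale covers in the definition of a normal crossings divisor (de Jong 1996, 2.4;
`IsNormalCrossingsDivisor`) — node F3 of the decomposition of `DeJong1996NormalCrossingsBlowup`
(`NormalCrossingsStrictification.lean`). Everything is PROVED.

* `Ideal.map_inf_of_flat`, `Ideal.map_finset_inf_of_flat` — extension of ideals along a flat
  algebra commutes with finite intersections (Matsumura Thm. 7.4 (i)).
* `Ideal.isRadical_map_of_isPrime_of_formallyUnramified`,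
  `Ideal.IsRadical.map_of_flat_of_formallyUnramified` — **along a flat, formally unramified,
  essentially finite-type algebra over a Noetherian ring, radical ideals extend to radical
  ideals** (the fibres `κ(𝔭) ⊗ B` are unramified over fields, hence reduced, Mathlib
  `Algebra.FormallyUnramified.isReduced_of_field`; `B/𝔭B ↪ κ(𝔭) ⊗ B/𝔭B` by flatness; a radical
  ideal is the intersection of its finitely many minimal primes).
* For a local homomorphism `A → B` of Noetherian local rings which is flat, formally unramified
  and essentially of finite type ("étale local"): `map_maximalIdeal_pow` (`𝔪_A^k B = 𝔪_B^k`,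
  Mathlib `Algebra.FormallyUnramified.map_maximalIdeal`), `map_le_maximalIdeal_pow_iff`
  (**orders of ideals are preserved**, faithful flatness), `ringKrullDim_eq_of_etaleLocal`
  (`dim B = dim A`, Mathlib's dimension formula `Ideal.height_eq_height_add_of_liesOver…`),
  `isRegularLocalRing_iff_of_etaleLocal` (Matsumura 23.7), and
  `isRsopPart_map_iff_of_etaleLocal` — **`z₁, …, z_n` is part of a regular system of parameters
  of `A` iff its image is one of `B`** (via the criterion
  `IsRsopPart.of_isRegularLocalRing_quotient` applied to the étale local `A/(z) → B/(z)B`).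

## Sources

* H. Matsumura, *Commutative Ring Theory*, CUP 1986, Thm. 7.4 (i), Thm. 15.1, Thm. 23.7,
  Thm. 23.9. [Matsumura1987]
* The Stacks Project, Tag 00UW (unramified local algebras), Tag 033B/039Q (étale over reduced
  is reduced), Tag 00ON (dimension formula). [StacksProject]
-/

noncomputable section

namespace Literature.AlgebraicGeometry.Resolution

universe u

open IsLocalRing TensorProduct

/-! ## Flat extension commutes with finite intersections -/

section Flat

variable {A B : Type*} [CommRing A] [CommRing B] [Algebra A B]

/-- **Extension of ideals along a flat algebra commutes with intersections** (Matsumura,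
Thm. 7.4 (i)): `(I ∩ J)B = IB ∩ JB`. Proof: `A/(I ∩ J) → A/I × A/J` is injective, hence so is
`B/(I ∩ J)B → B/IB × B/JB` after the flat base change. [cite: Matsumura1987, Thm. 7.4] -/
theorem Ideal.map_inf_of_flat [Module.Flat A B] (I J : Ideal A) :
    (I ⊓ J).map (algebraMap A B) = I.map (algebraMap A B) ⊓ J.map (algebraMap A B) := by
  refine le_antisymm (Ideal.map_inf_le _) ?_
  -- the injection `A/(I ∩ J) → A/I × A/J`
  let f : (A ⧸ (I ⊓ J)) →ₗ[A] (A ⧸ I) × (A ⧸ J) :=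
    LinearMap.prod (Submodule.mapQ _ _ LinearMap.id inf_le_left)
      (Submodule.mapQ _ _ LinearMap.id inf_le_right)
  have hf : Function.Injective f := by
    rw [← LinearMap.ker_eq_bot, LinearMap.ker_eq_bot']
    intro x hx
    obtain ⟨a, rfl⟩ := Submodule.Quotient.mk_surjective _ x
    have h1 : Submodule.mapQ (I ⊓ J) I LinearMap.id inf_le_left (Submodule.Quotient.mk a) = 0 :=
      congrArg Prod.fst hx
    have h2 : Submodule.mapQ (I ⊓ J) J LinearMap.id inf_le_right (Submodule.Quotient.mk a) = 0 :=
      congrArg Prod.snd hx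
    rw [Submodule.mapQ_apply, LinearMap.id_apply, Submodule.Quotient.mk_eq_zero] at h1 h2
    exact (Submodule.Quotient.mk_eq_zero _).mpr ⟨h1, h2⟩
  have hinj := Module.Flat.lTensor_preserves_injective_linearMap (M := B) f hf
  -- chase an element of `IB ∩ JB`
  intro b hb
  obtain ⟨hbI, hbJ⟩ := Submodule.mem_inf.mp hb
  let e := (Algebra.TensorProduct.quotIdealMapEquivTensorQuot B (I ⊓ J)).toLinearEquiv
  have h0 : (f.lTensor B) (e (Ideal.Quotient.mk _ b)) = 0 := by
    have : e (Ideal.Quotient.mk _ b) = b ⊗ₜ[A] (Submodule.Quotient.mk 1) := rfl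
    rw [this, LinearMap.lTensor_tmul]
    have hf1 : f (Submodule.Quotient.mk 1) = (Ideal.Quotient.mk I 1, Ideal.Quotient.mk J 1) := rfl
    rw [hf1]
    -- `b ⊗ (1, 1) ↦ (b ⊗ 1, b ⊗ 1) = (0, 0)` in `(B ⊗ A/I) × (B ⊗ A/J) ≅ B/IB × B/JB`
    apply (TensorProduct.prodRight A B B (A ⧸ I) (A ⧸ J)).injective
    rw [map_zero, TensorProduct.prodRight_tmul, Prod.mk_eq_zero]
    constructor
    · have h1 : (Algebra.TensorProduct.quotIdealMapEquivTensorQuot B I) (Ideal.Quotient.mk _ b) =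
          b ⊗ₜ[A] (Ideal.Quotient.mk I 1) := rfl
      change b ⊗ₜ[A] (Ideal.Quotient.mk I 1) = 0
      rw [← h1, Ideal.Quotient.eq_zero_iff_mem.mpr hbI, map_zero]
    · have h1 : (Algebra.TensorProduct.quotIdealMapEquivTensorQuot B J) (Ideal.Quotient.mk _ b) =
          b ⊗ₜ[A] (Ideal.Quotient.mk J 1) := rfl
      change b ⊗ₜ[A] (Ideal.Quotient.mk J 1) = 0
      rw [← h1, Ideal.Quotient.eq_zero_iff_mem.mpr hbJ, map_zero]
  rw [← map_zero (f.lTensor B)] at h0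
  have h1 := hinj h0
  rw [← map_zero e] at h1
  have h2 := e.injective h1
  exact Ideal.Quotient.eq_zero_iff_mem.mp h2

/-- Extension along a flat algebra commutes with finite intersections.
[cite: Matsumura1987, Thm. 7.4] -/
theorem Ideal.map_finset_inf_of_flat [Module.Flat A B] {ι : Type*} (s : Finset ι)
    (I : ι → Ideal A) :
    (s.inf I).map (algebraMap A B) = s.inf fun i => (I i).map (algebraMap A B) := by
  classical
  induction s using Finset.induction_on with
  | empty => rw [Finset.inf_empty, Finset.inf_empty]; exact Ideal.map_top _
  | insert i s hi ih => rw [Finset.inf_insert, Finset.inf_insert, Ideal.map_inf_of_flat, ih]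

end Flat

/-! ## Radical ideals extend to radical ideals along flat unramified algebras -/

section Radical

variable {A B : Type u} [CommRing A] [CommRing B] [Algebra A B]

/-- A flat, formally unramified, essentially finite-type algebra over a domain is reduced: it
embeds (flatness) into its generic fibre `K ⊗_A B`, which is formally unramified and essentially
of finite type over the field `K`, hence reduced (Mathlib
`Algebra.FormallyUnramified.isReduced_of_field`). [cite: StacksProject, Tag 039Q] -/
theorem isReduced_of_flat_of_formallyUnramified_of_isDomain [IsDomain A] [Module.Flat A B]
    [Algebra.FormallyUnramified A B] [Algebra.EssFiniteType A B] : IsReduced B := by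
  let K := FractionRing A
  -- `B → K ⊗ B` is injective by flatness
  let f : B →ₐ[A] K ⊗[A] B := Algebra.TensorProduct.includeRight
  have hf : Function.Injective f := by
    have : ⇑f = (LinearMap.rTensor B (Algebra.ofId A K).toLinearMap).comp
        (TensorProduct.lid A B).symm.toLinearMap := by
      ext x; simp [f]
    rw [this, LinearMap.coe_comp]
    refine Function.Injective.comp ?_ (TensorProduct.lid A B).symm.injective
    exact Module.Flat.rTensor_preserves_injective_linearMap _
      (fun x y h => IsFractionRing.injective A K h)
  haveI : IsReduced (K ⊗[A] B) := Algebra.FormallyUnramified.isReduced_of_field K (K ⊗[A] B)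
  exact isReduced_of_injective f hf

/-- **A prime ideal extends to a radical ideal** along a flat, formally unramified, essentially
finite-type algebra: `B/𝔭B` is such an algebra over the domain `A/𝔭`.
[cite: StacksProject, Tag 039Q] -/
theorem Ideal.isRadical_map_of_isPrime_of_formallyUnramified [Module.Flat A B]
    [Algebra.FormallyUnramified A B] [Algebra.EssFiniteType A B] (p : Ideal A) [p.IsPrime] :
    (p.map (algebraMap A B)).IsRadical := by
  rw [Ideal.isRadical_iff_quotient_reduced]
  haveI : Module.Flat (A ⧸ p) (B ⧸ p.map (algebraMap A B)) :=
    Module.Flat.of_linearEquiv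
      (Algebra.TensorProduct.quotIdealMapEquivQuotTensor B p).toLinearEquiv
  exact isReduced_of_flat_of_formallyUnramified_of_isDomain (A := A ⧸ p)

/-- **Radical ideals extend to radical ideals along a flat, formally unramified, essentially
finite-type algebra over a Noetherian ring** (e.g. along an étale ring map; Matsumura 23.9 /
Stacks 033B for the reducedness statement): `I = 𝔭₁ ∩ … ∩ 𝔭_k` (minimal primes), and
`IB = 𝔭₁B ∩ … ∩ 𝔭_kB` by flatness, each `𝔭ᵢB` being radical. [cite: StacksProject, Tag 033B] -/
theorem Ideal.IsRadical.map_of_flat_of_formallyUnramified [IsNoetherianRing A] [Module.Flat A B]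
    [Algebra.FormallyUnramified A B] [Algebra.EssFiniteType A B] {I : Ideal A}
    (hI : I.IsRadical) : (I.map (algebraMap A B)).IsRadical := by
  classical
  have hfin := I.finite_minimalPrimes_of_isNoetherianRing
  -- `I = ⨅ minimal primes`
  have hI' : I = hfin.toFinset.inf id := by
    conv_lhs => rw [← hI.radical, ← Ideal.sInf_minimalPrimes]
    rw [Finset.inf_id_eq_sInf, Set.Finite.coe_toFinset]
  rw [hI', Ideal.map_finset_inf_of_flat]
  -- a finite intersection of radical ideals is radical
  intro b ⟨k, hk⟩
  simp only [Finset.inf_eq_iInf, Submodule.mem_iInf] at hk ⊢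
  intro q hq
  have hqmin : q ∈ I.minimalPrimes := hfin.mem_toFinset.mp hq
  haveI : q.IsPrime := hqmin.1.1
  exact (Ideal.isRadical_map_of_isPrime_of_formallyUnramified (B := B) q) ⟨k, hk q hq⟩

end Radical

/-! ## Étale local homomorphisms of Noetherian local rings -/

section EtaleLocal

variable (A B : Type u) [CommRing A] [CommRing B] [Algebra A B] [IsLocalRing A] [IsLocalRing B]
  [IsLocalHom (algebraMap A B)]

/-- `𝔪_Aᵏ B = 𝔪_Bᵏ` for an unramified essentially finite-type local homomorphism.
[cite: StacksProject, Tag 00UW] -/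
theorem map_maximalIdeal_pow [Algebra.EssFiniteType A B] [Algebra.FormallyUnramified A B]
    (k : ℕ) : (maximalIdeal A ^ k).map (algebraMap A B) = maximalIdeal B ^ k := by
  rw [Ideal.map_pow, Algebra.FormallyUnramified.map_maximalIdeal]

variable {A B} in
/-- **Orders of ideals are invariant under étale local homomorphisms**: `IB ⊆ 𝔪_Bᵏ ↔ I ⊆ 𝔪_Aᵏ`
(flat local homomorphisms are faithfully flat, so `IB ∩ A = I`, and `𝔪_Bᵏ = 𝔪_Aᵏ B`).
[cite: Matsumura1987, Thm. 7.5] -/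
theorem map_le_maximalIdeal_pow_iff [Module.Flat A B] [Algebra.EssFiniteType A B]
    [Algebra.FormallyUnramified A B] (I : Ideal A) (k : ℕ) :
    I.map (algebraMap A B) ≤ maximalIdeal B ^ k ↔ I ≤ maximalIdeal A ^ k := by
  haveI : Module.FaithfullyFlat A B := Module.FaithfullyFlat.of_flat_of_isLocalHom
  constructor
  · intro h
    rw [← Ideal.comap_map_eq_self_of_faithfullyFlat (B := B) I,
      ← Ideal.comap_map_eq_self_of_faithfullyFlat (B := B) (maximalIdeal A ^ k)]
    refine Ideal.comap_mono (h.trans ?_)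
    rw [map_maximalIdeal_pow]
  · intro h
    rw [← map_maximalIdeal_pow A B k]
    exact Ideal.map_mono h

/-- **`dim B = dim A`** for a flat unramified essentially finite-type local homomorphism of
Noetherian local rings (dimension formula for the flat local homomorphism with closed fibre the
field `B/𝔪_A B = B/𝔪_B`, Matsumura Thm. 15.1). [cite: Matsumura1987, Thm. 15.1] -/
theorem ringKrullDim_eq_of_etaleLocal [IsNoetherianRing A] [IsNoetherianRing B] [Module.Flat A B]
    [Algebra.EssFiniteType A B] [Algebra.FormallyUnramified A B] :
    ringKrullDim B = ringKrullDim A := by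
  have h := Ideal.height_eq_height_add_of_liesOver_of_hasGoingDown (maximalIdeal A) (maximalIdeal B)
  rw [Algebra.FormallyUnramified.map_maximalIdeal, Ideal.map_quotient_self, Ideal.height_bot,
    add_zero] at h
  rw [← IsLocalRing.maximalIdeal_height_eq_ringKrullDim,
    ← IsLocalRing.maximalIdeal_height_eq_ringKrullDim, h]

/-- **Regularity is invariant under étale local homomorphisms** (descent: Matsumura 23.7 (i);
ascent: `𝔪_B = 𝔪_A B` needs at most `emb dim A = dim A = dim B` generators).
[cite: Matsumura1987, Thm. 23.7] -/
theorem isRegularLocalRing_iff_of_etaleLocal [IsNoetherianRing A] [IsNoetherianRing B]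
    [Module.Flat A B] [Algebra.EssFiniteType A B] [Algebra.FormallyUnramified A B] :
    IsRegularLocalRing B ↔ IsRegularLocalRing A := by
  constructor
  · intro hB
    exact IsRegularLocalRing.of_flat_of_isLocalHom A B
  · intro hA
    apply IsRegularLocalRing.of_spanFinrank_maximalIdeal_le
    rw [ringKrullDim_eq_of_etaleLocal A B, ← IsRegularLocalRing.spanFinrank_maximalIdeal,
      ← Algebra.FormallyUnramified.map_maximalIdeal (R := A)]
    -- `𝔪_A B` is generated by the images of a minimal basis of `𝔪_A`
    obtain ⟨s, hs, hspan⟩ := Submodule.FG.exists_span_finset_card_eq_spanFinrank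
      (maximalIdeal A).fg_of_isNoetherianRing
    have : (maximalIdeal A).map (algebraMap A B) =
        Ideal.span ((algebraMap A B) '' (s : Set A)) := by
      rw [← hspan]
      exact Ideal.map_span (algebraMap A B) (s : Set A)
    rw [this]
    refine WithBot.coe_le_coe.mpr (Nat.cast_le.mpr ?_)
    refine (Submodule.spanFinrank_span_le_ncard_of_finite ((Finset.finite_toSet s).image _)).trans
      ?_
    rw [← hs]
    exact (Set.ncard_image_le (Finset.finite_toSet s)).trans (by rw [Set.ncard_coe_finset])

end EtaleLocal

/-! ## Regular parameters along étale local homomorphisms -/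

section Rsop

variable {A B : Type u} [CommRing A] [CommRing B] [Algebra A B] [IsLocalRing A] [IsLocalRing B]
  [IsLocalHom (algebraMap A B)]

omit [IsLocalRing A] in
/-- The quotient `A/I → B/IB` of a local homomorphism into a local ring is a local
homomorphism (units of `B/IB` lift to units of `B`). [folklore] -/
theorem isLocalHom_quotient_map (I : Ideal A) [Nontrivial (B ⧸ I.map (algebraMap A B))] :
    IsLocalHom (algebraMap (A ⧸ I) (B ⧸ I.map (algebraMap A B))) := by
  haveI := IsLocalRing.of_surjective' (Ideal.Quotient.mk (I.map (algebraMap A B)))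
    Ideal.Quotient.mk_surjective
  refine ⟨fun a ha => ?_⟩
  obtain ⟨a, rfl⟩ := Ideal.Quotient.mk_surjective a
  have h1 : algebraMap (A ⧸ I) (B ⧸ I.map (algebraMap A B)) (Ideal.Quotient.mk I a) =
      Ideal.Quotient.mk _ (algebraMap A B a) := rfl
  rw [h1] at ha
  -- a unit of `B/IB` lifts to a unit of `B` (local ring), hence `a` is a unit of `A`
  have hB : IsUnit (algebraMap A B a) := by
    by_contra hna
    have hmem : algebraMap A B a ∈ maximalIdeal B := hna
    have : Ideal.Quotient.mk (I.map (algebraMap A B)) (algebraMap A B a) ∈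
        maximalIdeal (B ⧸ I.map (algebraMap A B)) := by
      haveI : IsLocalHom (Ideal.Quotient.mk (I.map (algebraMap A B))) :=
        IsLocalHom.of_surjective _ Ideal.Quotient.mk_surjective
      exact map_nonunit _ _ hmem
    exact this ha
  exact (isUnit_map_iff (algebraMap A B) a).mp hB |>.map _

/-- **Parts of regular systems of parameters via the quotient** (Matsumura 14.2 (1) ⇔ (3),
with the Remark that (3) ⇒ (1) needs no regularity of the ring): in a Noetherian local ring,
`z₁, …, z_n` is part of a regular system of parameters iff the `zᵢ` lie in `𝔪`, the quotient
`R/(z)` is a regular local ring, and `dim R/(z) + n = dim R`. [cite: Matsumura1987, Thm. 14.2] -/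
theorem isRsopPart_iff_quotient {R : Type u} [CommRing R] [IsLocalRing R] [IsNoetherianRing R]
    {n : ℕ} (z : Fin n → R) :
    IsRsopPart z ↔ (∀ i, z i ∈ maximalIdeal R) ∧
      IsRegularLocalRing (R ⧸ Ideal.span (Set.range z)) ∧
        ringKrullDim (R ⧸ Ideal.span (Set.range z)) + n = ringKrullDim R := by
  constructor
  · intro h
    exact ⟨h.mem_maximalIdeal, h.isRegularLocalRing_quotient, h.ringKrullDim_quotient_add⟩
  · rintro ⟨hzm, hreg, hdim⟩
    haveI := hreg
    exact IsRsopPart.of_isRegularLocalRing_quotient hzm hdim.le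

/-- **Parts of regular systems of parameters of `A`, read off in `B`**: for a flat, unramified,
essentially finite-type local homomorphism `A → B` of Noetherian local rings, `z₁, …, z_n ∈ A`
is part of a regular system of parameters of `A` iff the `zᵢ` lie in `𝔪_A`, `B/(z)B` is a
regular local ring and `dim B/(z)B + n = dim B` — the quotient `A/(z) → B/(z)B` is again étale
local, so regularity and dimension are read off upstairs. [cite: Matsumura1987, Thm. 23.7] -/
theorem isRsopPart_iff_quotient_map_of_etaleLocal [IsNoetherianRing A] [IsNoetherianRing B]
    [Module.Flat A B] [Algebra.EssFiniteType A B] [Algebra.FormallyUnramified A B] {n : ℕ}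
    (z : Fin n → A) :
    IsRsopPart z ↔ (∀ i, z i ∈ maximalIdeal A) ∧
      IsRegularLocalRing (B ⧸ (Ideal.span (Set.range z)).map (algebraMap A B)) ∧
        ringKrullDim (B ⧸ (Ideal.span (Set.range z)).map (algebraMap A B)) + n =
          ringKrullDim B := by
  rw [isRsopPart_iff_quotient]
  refine and_congr_right fun hzm => ?_
  -- the étale local homomorphism `A/I → B/IB`
  set I : Ideal A := Ideal.span (Set.range z) with hI
  have hzmB : ∀ i, (algebraMap A B ∘ z) i ∈ maximalIdeal B := fun i =>
    map_nonunit (algebraMap A B) (z i) (hzm i)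
  have hIB : I.map (algebraMap A B) = Ideal.span (Set.range (algebraMap A B ∘ z)) := by
    rw [hI, Ideal.map_span, Set.range_comp]
  have hItop : I ≠ ⊤ := fun h => (maximalIdeal.isMaximal A).ne_top
    (top_le_iff.mp (h ▸ (Ideal.span_le.mpr (Set.range_subset_iff.mpr hzm) : I ≤ maximalIdeal A)))
  have hIBtop : I.map (algebraMap A B) ≠ ⊤ := fun h => (maximalIdeal.isMaximal B).ne_top
    (top_le_iff.mp (h ▸ hIB ▸ (Ideal.span_le.mpr (Set.range_subset_iff.mpr hzmB) :
      Ideal.span (Set.range (algebraMap A B ∘ z)) ≤ maximalIdeal B)))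
  haveI : Nontrivial (A ⧸ I) := Ideal.Quotient.nontrivial_iff.mpr hItop
  haveI : Nontrivial (B ⧸ I.map (algebraMap A B)) := Ideal.Quotient.nontrivial_iff.mpr hIBtop
  haveI hlA := IsLocalRing.of_surjective' (Ideal.Quotient.mk I) Ideal.Quotient.mk_surjective
  haveI hlB := IsLocalRing.of_surjective' (Ideal.Quotient.mk (I.map (algebraMap A B)))
    Ideal.Quotient.mk_surjective
  haveI : IsLocalHom (algebraMap (A ⧸ I) (B ⧸ I.map (algebraMap A B))) :=
    isLocalHom_quotient_map I
  haveI : Module.Flat (A ⧸ I) (B ⧸ I.map (algebraMap A B)) :=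
    Module.Flat.of_linearEquiv
      (Algebra.TensorProduct.quotIdealMapEquivQuotTensor B I).toLinearEquiv
  have hdimq : ringKrullDim (B ⧸ I.map (algebraMap A B)) = ringKrullDim (A ⧸ I) :=
    ringKrullDim_eq_of_etaleLocal (A ⧸ I) (B ⧸ I.map (algebraMap A B))
  have hregq : IsRegularLocalRing (B ⧸ I.map (algebraMap A B)) ↔ IsRegularLocalRing (A ⧸ I) :=
    isRegularLocalRing_iff_of_etaleLocal (A ⧸ I) (B ⧸ I.map (algebraMap A B))
  have hdim : ringKrullDim B = ringKrullDim A := ringKrullDim_eq_of_etaleLocal A B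
  rw [hregq, hdimq, hdim]

/-- **Being part of a regular system of parameters is invariant under étale local
homomorphisms**: for a flat, unramified, essentially finite-type local homomorphism `A → B`
of Noetherian local rings and `z₁, …, z_n ∈ A`, the `zᵢ` are part of a regular system of
parameters of `A` iff their images are part of one of `B`. [cite: Matsumura1987, Thm. 23.7] -/
theorem isRsopPart_map_iff_of_etaleLocal [IsNoetherianRing A] [IsNoetherianRing B]
    [Module.Flat A B] [Algebra.EssFiniteType A B] [Algebra.FormallyUnramified A B] {n : ℕ}
    (z : Fin n → A) : IsRsopPart (algebraMap A B ∘ z) ↔ IsRsopPart z := by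
  rw [isRsopPart_iff_quotient_map_of_etaleLocal (B := B) z, isRsopPart_iff_quotient]
  have hIB : (Ideal.span (Set.range z)).map (algebraMap A B) =
      Ideal.span (Set.range (algebraMap A B ∘ z)) := by
    rw [Ideal.map_span, Set.range_comp]
  have hm : (∀ i, (algebraMap A B ∘ z) i ∈ maximalIdeal B) ↔ ∀ i, z i ∈ maximalIdeal A :=
    forall_congr' fun i => (map_mem_nonunits_iff (algebraMap A B) (z i))
  rw [hm, ← hIB]

end Rsop

end Literature.AlgebraicGeometry.Resolution

end
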